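import Summits.HodgeConjecture.CorCM.GaloisOddPrimeNormalShapes
import HarnessLib

/-!
# DEGREE `32·p`: the five shapes for every odd prime `p ∉ {5, 7}` — no size hypothesis

COR-CM (cell `pub-hodgecm2`), binder seat b04 (gen 38), count-neutral own lane «Galois-CM-type classification».  KERNEL ONLY:
theorems; no definition, no named fact, no `sorry`.  `HC_CM` is neither used nor claimed.

For `[K:ℚ] = 2⁵·p` the three normality sources of gen 38 cover every odd prime except `5` and `7`: `p = 3` by gen 33's threshold
(`m = 16 ≥ 14`), `p ≥ 31` by `CorCM/GaloisNormalSylow` (no hypothesis), and `p ∈ {11, 13, 17, 19, 23, 29}` by Sylow counting — no divisor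
`2ⁱ` (`1 ≤ i ≤ 5`) of the index `32` is `≡ 1 (mod p)` (`ord_p(2) > 5`; for `p = 5, 7, 31` one has `16 ≡ 1 (5)`, `8 ≡ 1 (7)`, `32 ≡ 1 (31)`,
and `p = 31` is handled by the first source).  Hence (`shapes_thirtytwo_mul_prime`): **a GOOD Galois CM field of degree `32·p`, `p` an odd
prime other than `5, 7`, has `Gal(K/ℚ) = C_p ⋊ S` with `S` (any Sylow `2`-subgroup, of order `32`) cyclic — shape C(r) — or `S ≃ Q₃₂` —
shapes Q×, Dic, QK.**  (`p = 5, 7`: the Sylow `p`-subgroup of `Gal/O_p` may fail to be normal, `n₅ = 16`, `n₇ = 8`; open.)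

## References

* [Rotman1995] J. J. Rotman, *An Introduction to the Theory of Groups*, 4th ed., GTM 148, Thm. 4.12, Thm. 5.46, Thm. 7.41.
* [Shimura1998] G. Shimura, *Abelian Varieties with Complex Multiplication and Modular Functions*, §8.2 Prop. 26, §32.10.
* [Dodson1984] B. Dodson, *The structure of Galois groups of CM-fields*, Trans. AMS 283 (1984), §5.
-/

noncomputable section

open CategoryTheory CategoryTheory.Limits NumberField
open scoped BigOperators

namespace Summit.HodgeConjecture.CorCM.GaloisModels

open Literature.NumberTheory.ComplexMultiplication Literature.AlgebraicGeometry.HodgeTheory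
open Literature.AlgebraicGeometry.Motives (AbelianVariety CMType)
open Literature.AlgebraicGeometry.Pohlmann1968 Summit.HodgeConjecture.CorCM.GaloisRank

/-- The divisors of `32` other than `1` are not `≡ 1 (mod p)` for `p ∈ {11, 13, 17, 19, 23, 29}`. [folklore] -/
theorem eq_one_of_dvd_thirtytwo_of_modEq {p d : ℕ} (hp : p = 11 ∨ p = 13 ∨ p = 17 ∨ p = 19 ∨ p = 23 ∨ p = 29) (hd : d ∣ 2 ^ 5)
    (hmod : d ≡ 1 [MOD p]) : d = 1 := by
  obtain ⟨i, hi, rfl⟩ := (Nat.dvd_prime_pow Nat.prime_two).1 hd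
  unfold Nat.ModEq at hmod
  rcases hp with rfl | rfl | rfl | rfl | rfl | rfl <;> interval_cases i <;> simp_all (config := {decide := true})

variable {K : Type} [Field K] [NumberField K] [IsCMField K] [IsGalois ℚ K]

/-- **DEGREE `32·p`, `p` AN ODD PRIME `∉ {5, 7}`: THE FIVE SHAPES, with no size hypothesis.**  If every primitive CM type of the Galois CM
field `K` of degree `32·p` is nondegenerate, then every Sylow `2`-subgroup `S` of `Gal(K/ℚ)` has order `32` and either `S = ⟨x⟩` is cyclic
and `Gal(K/ℚ) = ⟨u⟩ ⋊ ⟨x⟩` with `x u x⁻¹ = uʳ` (shape C(r)), or `S = ⟨a, x⟩ ≃ Q₃₂` acting on `⟨u⟩ ≅ C_p` through `±1` in one of the three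
ways Q×, Dic, QK. [cite: Rotman1995, Thm. 4.12, Thm. 5.46 and Thm. 7.41] [cite: Shimura1998, §8.2 Prop. 26 and §32.10] [cite: Dodson1984, §5] -/
theorem shapes_thirtytwo_mul_prime {p : ℕ} [hp : Fact p.Prime] (hp2 : p ≠ 2) (hp5 : p ≠ 5) (hp7 : p ≠ 7)
    (hdeg : Module.finrank ℚ K = 32 * p)
    (hgood : ∀ (Φ : CMType K) (φ : K →+* ℂ), IsPrimitive (ℂ ≃+* ℂ) Φ.1 φ → IsNondegenerate Φ) [Fact (Nat.Prime 2)]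
    (S : Sylow 2 (K ≃ₐ[ℚ] K)) : Nat.card (S : Subgroup (K ≃ₐ[ℚ] K)) = 2 ^ 5 ∧
      ((IsCyclic (S : Subgroup (K ≃ₐ[ℚ] K)) ∧ ∃ u x : K ≃ₐ[ℚ] K, orderOf u = p ∧ (Subgroup.zpowers u).Normal ∧ orderOf x = 2 ^ 5 ∧
          Subgroup.zpowers x = (S : Subgroup (K ≃ₐ[ℚ] K)) ∧ (∀ g : K ≃ₐ[ℚ] K, ∃ j i : ℕ, g = u ^ j * x ^ i) ∧
          ∃ r : ℕ, x * u * x⁻¹ = u ^ r) ∨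
       (Nonempty ((S : Subgroup (K ≃ₐ[ℚ] K)) ≃* QuaternionGroup (2 ^ (5 - 2))) ∧
          ∃ u a x : K ≃ₐ[ℚ] K, orderOf u = p ∧ (Subgroup.zpowers u).Normal ∧ orderOf a = 2 ^ (5 - 1) ∧
            a ∈ (S : Subgroup (K ≃ₐ[ℚ] K)) ∧ x ∈ (S : Subgroup (K ≃ₐ[ℚ] K)) ∧ x ∉ Subgroup.zpowers a ∧ x * a = a⁻¹ * x ∧
            x * x = a ^ 2 ^ (5 - 2) ∧ (∀ g : K ≃ₐ[ℚ] K, ∃ j i : ℕ, g = u ^ j * a ^ i ∨ g = u ^ j * (x * a ^ i)) ∧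
            ((a * u * a⁻¹ = u ∧ x * u * x⁻¹ = u) ∨ (a * u * a⁻¹ = u ∧ x * u * x⁻¹ = u⁻¹) ∨
              (a * u * a⁻¹ = u⁻¹ ∧ x * u * x⁻¹ = u)))) := by
  classical
  have hpp := hp.out
  have hdeg' : Module.finrank ℚ K = 2 ^ 5 * p := by rw [hdeg]; norm_num
  -- Sylow counting for `p ∈ {11, …, 29}`
  by_cases hmid : p = 11 ∨ p = 13 ∨ p = 17 ∨ p = 19 ∨ p = 23 ∨ p = 29
  · exact shapes_of_forall_dvd hp2 hdeg' le_rfl (fun d hd hmod => eq_one_of_dvd_thirtytwo_of_modEq hmid hd hmod) hgood S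
  -- otherwise `p = 3` or `p ≥ 31`: the size-condition form (vacuous for `p ≥ 31`, `m = 16 ≥ 14` for `p = 3`)
  have hp331 : p = 3 ∨ 31 ≤ p := by
    by_cases h31 : 31 ≤ p
    · exact Or.inr h31
    left
    have hlt : p < 31 := by omega
    interval_cases p <;> first | omega | exact absurd hpp (by norm_num)
  have hsize : ∀ q a m : ℕ, q.Prime → q ≠ 2 → q < 31 → Module.finrank ℚ K = 2 * q ^ a * m → ¬ q ∣ m → 1 ≤ a →
      16 ≤ m ∧ (q = 3 ∨ 8 * q ≤ 2 ^ (m / 4)) := by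
    intro q a m hq hq2 hq31 hd hqm ha
    -- `q ∣ 32 p` with `q` odd ⟹ `q = p`
    have hqp : q = p := by
      have h1 : q ∣ 2 ^ 5 * p := by
        rw [← hdeg', hd, mul_assoc]
        exact Dvd.dvd.mul_left (dvd_mul_of_dvd_left (dvd_pow_self q (by omega)) m) 2
      rcases (Nat.Prime.dvd_mul hq).1 h1 with h | h
      · exact absurd ((Nat.prime_dvd_prime_iff_eq hq Nat.prime_two).1 (hq.dvd_of_dvd_pow h)) hq2
      · exact (Nat.prime_dvd_prime_iff_eq hq hpp).1 h
    subst hqp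
    rcases hp331 with rfl | h31
    · -- `q = 3`: `2 · 3ᵃ · m = 96`, `3 ∤ m` ⟹ `a = 1`, `m = 16`
      have h3 : 3 ^ a * m = 48 := by
        have h := hd.symm.trans hdeg'
        rw [mul_assoc] at h
        have h' : 2 * (3 ^ a * m) = 2 * 48 := by rw [h]; norm_num
        exact Nat.eq_of_mul_eq_mul_left two_pos h'
      have ha1 : a = 1 := by
        rcases Nat.lt_or_ge a 2 with h | h
        · omega
        · exfalso
          have h9 : 9 ∣ 3 ^ a * m := Dvd.dvd.mul_right (pow_dvd_pow 3 h) m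
          rw [h3] at h9
          exact absurd h9 (by norm_num)
      subst ha1
      refine ⟨by omega, Or.inl rfl⟩
    · omega
  rcases structure_of_forall_isNondegenerate hdeg' (hpp.odd_of_ne_two hp2) le_rfl hsize hgood with ⟨h1, -⟩ | ⟨-, -, hall⟩
  · exact absurd h1 hpp.one_lt.ne'
  · obtain ⟨hcardS, hS⟩ := hall S
    refine ⟨hcardS, ?_⟩
    rcases hS with h | h
    · refine Or.inl ⟨?_, h⟩
      obtain ⟨u, x, -, -, -, hSx, -⟩ := h
      rw [← hSx]
      infer_instance
    · refine Or.inr ⟨?_, h⟩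
      obtain ⟨hcS, hq⟩ := sylow_two_isCyclic_or_quaternion_of_odd_prime' hdeg' (hpp.odd_of_ne_two hp2) le_rfl hpp.one_lt.ne' hsize
        hgood S
      rcases hq with hc | hq
      · -- cyclic `S` of order `32` has an element of order `32`; but `a ∈ S` has order `16` and `x ∉ ⟨a⟩`: use the quaternion data
        obtain ⟨u, a, x, -, -, hoa, haS, hxS, hxa, hxa', -, -⟩ := h
        exfalso
        -- in a cyclic group the subgroup of order `16` is unique and contains every element of order dividing `16`... simpler:
        -- `x a = a⁻¹ x` with `S` abelian gives `a = a⁻¹`, `a² = 1`, contradicting `orderOf a = 16`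
        haveI := hc
        have hcomm : x * a = a * x := by
          obtain ⟨g, hg⟩ := IsCyclic.exists_generator (α := (S : Subgroup (K ≃ₐ[ℚ] K)))
          obtain ⟨i, hi⟩ := Subgroup.mem_zpowers_iff.1 (hg ⟨x, hxS⟩)
          obtain ⟨j, hj⟩ := Subgroup.mem_zpowers_iff.1 (hg ⟨a, haS⟩)
          have hi' : ((g : (S : Subgroup (K ≃ₐ[ℚ] K))) : K ≃ₐ[ℚ] K) ^ i = x := by rw [← Subgroup.coe_zpow, hi]
          have hj' : ((g : (S : Subgroup (K ≃ₐ[ℚ] K))) : K ≃ₐ[ℚ] K) ^ j = a := by rw [← Subgroup.coe_zpow, hj]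
          rw [← hi', ← hj', ← zpow_add, ← zpow_add, add_comm]
        have ha2 : a * a = 1 := by
          have h := hxa'
          rw [hcomm] at h
          have h' : a = a⁻¹ := mul_right_cancel h
          calc a * a = a * a⁻¹ := by rw [← h']
            _ = 1 := mul_inv_cancel a
        have hd : orderOf a ∣ 2 := orderOf_dvd_of_pow_eq_one (by rw [pow_two, ha2])
        rw [hoa] at hd
        norm_num at hd
      · exact hq

end Summit.HodgeConjecture.CorCM.GaloisModels

end
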